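import Literature.Algebra.Homology.RightDerivedFunctorPlusInjectiveModel
import Literature.AlgebraicGeometry.Modules.ModulesGrothendieckAbelian
import Literature.AlgebraicGeometry.Modules.PushforwardInjectiveResolution
import HarnessLib

/-!
# The derived direct image `Rf_* : D⁺(Mod 𝒪_X) ⥤ D⁺(Mod 𝒪_Y)` of an ARBITRARY morphism of schemes
# (injective model): definition, shift, `Rf_*(E•) ≅ f_*(I•)` on injective resolutions, and `Rf_* = f_*` for
# `f` affine on quasi-coherent complexes (Hartshorne III §1, III §8; Weibel 10.5.6; Stacks 01XC)

Layer `Literature/AlgebraicGeometry/Modules`. For a morphism of schemes `f : X ⟶ Y` — no hypothesis: not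
affine, not proper, not flat — the category `Mod(𝒪_X)` of ALL `𝒪_X`-modules has enough injectives
(`Modules/ModulesGrothendieckAbelian.enoughInjectives_modules`), so the right derived functor of the direct
image `f_* = Scheme.Modules.pushforward f` on the bounded-below derived category exists in the injective
model `D⁺(Mod 𝒪_X) ≌ K⁺(Inj) ⥤[f_*] K⁺(Mod 𝒪_Y) ⥤ D⁺(Mod 𝒪_Y)`; concretely it is Mathlib's
`Functor.rightDerivedFunctorPlus` (`Algebra/Homology/RightDerivedFunctorPlusInjectiveModel` for the model,
the shift and the computation on resolutions). Contents (everything PROVED; 0 named facts; no instances):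

* **`derivedPushforwardPlus f : DerivedCategory.Plus X.Modules ⥤ DerivedCategory.Plus Y.Modules`** (`Rf_*`),
  its unit `derivedPushforwardPlusUnit f : K⁺(f_*) ⋙ q ⟶ q ⋙ Rf_*`, the universal property
  (`isRightDerivedFunctor_derivedPushforwardPlus`), and **`commShiftDerivedPushforwardPlus f : (Rf_*).CommShift ℤ`**
  (a `def`; bind with `letI`).
* `isIso_derivedPushforwardPlusUnit_app` (the unit is an iso on bounded-below complexes of injectives),
  **`derivedPushforwardPlusObjIso f ι : Rf_*(Q E•) ≅ Q(f_*I•)`** for a quasi-isomorphism `ι : E• ⟶ I•` into a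
  bounded-below complex of injective `𝒪_X`-modules, `derivedPushforwardPlusModelIso` (`Rf_*` on `K⁺(Inj)` is the
  termwise `f_*`), `exists_injective_resolution` (bookkeeping: every `E• ∈ C⁺` has one, in the same degrees).
* **`nonempty_derivedPushforwardPlus_obj_iso_of_isAffineHom`**: for `f` AFFINE and `E•` a bounded-below complex
  of affine-localizing (e.g. quasi-coherent) modules, `Rf_*(Q E•) ≅ Q(f_*E•)` — the tree's Leray acyclicity
  lemma `Modules/PushforwardInjectiveResolution.quasiIso_pushforward_map_of_injective` read in `D⁺`; so this
  `Rf_*` extends the termwise direct image of the affine-only `Modules/PullbackPushforwardDerivedAdjunction`.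

Not here (recorded): `Rf_*` on the unbounded derived category (needs K-injective resolutions of unbounded
complexes); coherence ∕ boundedness of `Rf_*` for `f` proper (higher direct images of coherent sheaves);
`R(g ∘ f)_* ≅ Rg_* ∘ Rf_*`; base change and the projection formula. Typed for the cell `pub-hodge-ring2`
(brick (1b-α) of the (M1) library debt of crux 26512: the derived push-forward along the proper, non-affine
projection `p₂ : A × Â → Â` feeding the Fourier–Mukai functor `E• ↦ Rp₂_*(p₁^*E• ⊗ 𝒫)`); a research route
conditional on HC_CM, not a corollary — nothing in this file refers to it.

## References

* R. Hartshorne, *Algebraic Geometry*, GTM 52 (1977), III §1 (derived functors; Thm. 1.1A), III §8 p. 250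
  (higher direct images `R^i f_*` as right derived functors of `f_*`; Prop. 8.1). [Hartshorne1977]
* C. A. Weibel, *An introduction to homological algebra* (1994), Def. 10.5.1, Existence Thm. 10.5.6,
  Cor. 10.5.9. [Weibel1994]
* The Stacks Project, Tag 01XC (affine morphisms: higher direct images of quasi-coherent modules vanish).
  [StacksProject]
-/

noncomputable section

-- `TopCat.Presheaf`/`Scheme.Modules` are not reducible (as in Mathlib's `AlgebraicGeometry/Modules/Sheaf.lean`).
set_option backward.isDefEq.respectTransparency false

open CategoryTheory CategoryTheory.Limits AlgebraicGeometry

universe w w' u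

namespace Literature.AlgebraicGeometry.Modules

variable {X Y : Scheme.{u}} (f : X ⟶ Y) [HasDerivedCategory.{w} X.Modules] [HasDerivedCategory.{w'} Y.Modules]

/-! ### The functor -/

/-- **The derived direct image `Rf_* : D⁺(Mod 𝒪_X) ⥤ D⁺(Mod 𝒪_Y)`** of a morphism of schemes `f : X ⟶ Y`, on
the bounded-below derived categories of ALL `𝒪`-modules: the right derived functor of the (additive, left
exact) direct image `f_* : Mod(𝒪_X) ⥤ Mod(𝒪_Y)` in the injective model — `Mod(𝒪_X)` has enough injectives
(`Modules/ModulesGrothendieckAbelian`), so `Rf_*` is Mathlib's `Functor.rightDerivedFunctorPlus` of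
`Scheme.Modules.pushforward f` (the total right derived functor for the injective right-derivability structure
`K⁺(Inj) → K⁺`). No hypothesis on `f` (affine, proper, flat, …) is needed for the DEFINITION.
[cite: Hartshorne1977, III §1 Thm. 1.1A and III §8 (definition of `R^i f_*`, p. 250)] [cite: Weibel1994, Existence Thm. 10.5.6] -/
def derivedPushforwardPlus : DerivedCategory.Plus X.Modules ⥤ DerivedCategory.Plus Y.Modules :=
  (Scheme.Modules.pushforward f).rightDerivedFunctorPlus

/-- `Rf_*` is `(f_*).rightDerivedFunctorPlus` (unfolding). [cite: Weibel1994, Existence Thm. 10.5.6] -/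
theorem derivedPushforwardPlus_def :
    derivedPushforwardPlus f = (Scheme.Modules.pushforward f).rightDerivedFunctorPlus := rfl

/-- The unit `ξ : q ∘ f_* ⟶ Rf_* ∘ q` of the derived direct image on the bounded-below homotopy categories
(`q : K⁺ ⥤ D⁺` the localisation): the universal natural transformation making `Rf_*` a right derived
functor of `K⁺(f_*)`. [cite: Weibel1994, Def. 10.5.1 and Existence Thm. 10.5.6] -/
def derivedPushforwardPlusUnit :
    (Scheme.Modules.pushforward f).mapHomotopyCategoryPlus ⋙ DerivedCategory.Plus.Qh ⟶
      DerivedCategory.Plus.Qh ⋙ derivedPushforwardPlus f :=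
  (Scheme.Modules.pushforward f).rightDerivedFunctorPlusUnit

/-- `(Rf_*, ξ)` IS a right derived functor of `K⁺(f_*) : K⁺(Mod 𝒪_X) ⥤ K⁺(Mod 𝒪_Y) ⥤ D⁺(Mod 𝒪_Y)` with respect
to quasi-isomorphisms (universal property). [cite: Weibel1994, Def. 10.5.1 and Existence Thm. 10.5.6] -/
theorem isRightDerivedFunctor_derivedPushforwardPlus :
    (derivedPushforwardPlus f).IsRightDerivedFunctor (derivedPushforwardPlusUnit f)
      (HomotopyCategory.Plus.quasiIso X.Modules) :=
  inferInstanceAs ((Scheme.Modules.pushforward f).rightDerivedFunctorPlus.IsRightDerivedFunctor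
    (Scheme.Modules.pushforward f).rightDerivedFunctorPlusUnit (HomotopyCategory.Plus.quasiIso X.Modules))

/-- **`Rf_*` commutes with the shifts** (`Rf_*(E•⟦n⟧) ≅ (Rf_*E•)⟦n⟧`, functorially and additively in `n`):
the structure transported from the injective model `D⁺ ≌ K⁺(Inj) ⥤[f_*] K⁺ ⥤ D⁺`
(`Functor.commShiftRightDerivedFunctorPlus`). A `def`, not an instance (use `letI`).
[cite: Weibel1994, Existence Thm. 10.5.6 (RF = qFU, a morphism of triangulated categories)] -/
@[implicit_reducible]
def commShiftDerivedPushforwardPlus : (derivedPushforwardPlus f).CommShift ℤ :=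
  (Scheme.Modules.pushforward f).commShiftRightDerivedFunctorPlus

/-! ### `Rf_*` is computed on injective resolutions -/

/-- The unit `f_*I• ⟶ Rf_*I•` is an isomorphism in `D⁺(Mod 𝒪_Y)` for every bounded-below complex `I•` of
injective `𝒪_X`-modules. [cite: Weibel1994, Existence Thm. 10.5.6 (`R⁺F(I) ≅ qF(I)`)]
[cite: Hartshorne1977, III Prop. 8.1 proof (computing `R^i f_*` by an injective resolution)] -/
theorem isIso_derivedPushforwardPlusUnit_app (K : HomotopyCategory.Plus X.Modules)
    [∀ n : ℤ, Injective (K.obj.as.X n)] : IsIso ((derivedPushforwardPlusUnit f).app K) :=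
  (Scheme.Modules.pushforward f).isIso_rightDerivedFunctorPlusUnit_app K

/-- **`Rf_*(E•) ≅ f_*(I•)` for an injective resolution `ι : E• ⥲ I•`**: `ι` a quasi-isomorphism of
bounded-below complexes of `𝒪_X`-modules with every `Iⁿ` injective; then `Rf_*(Q E•) ≅ Q(f_*I•)` in
`D⁺(Mod 𝒪_Y)`, `f_*I•` the termwise direct image. [cite: Weibel1994, Existence Thm. 10.5.6]
[cite: Hartshorne1977, III §8 Prop. 8.1 (proof)] -/
def derivedPushforwardPlusObjIso {E I : CochainComplex.Plus X.Modules} (ι : E ⟶ I) [QuasiIso ι.hom]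
    [∀ n : ℤ, Injective (I.obj.X n)] :
    (derivedPushforwardPlus f).obj (DerivedCategory.Plus.Q.obj E) ≅
      DerivedCategory.Plus.Q.obj ((Scheme.Modules.pushforward f).mapCochainComplexPlus.obj I) :=
  (Scheme.Modules.pushforward f).rightDerivedFunctorPlusObjIso ι

/-- **`Rf_*` restricted to the injective model is the termwise `f_*`**:
`K⁺(Inj Mod 𝒪_X) ⥤ D⁺(Mod 𝒪_X) ⥤[Rf_*] D⁺(Mod 𝒪_Y)` ≅ `K⁺(Inj Mod 𝒪_X) ⥤[f_*] K⁺(Mod 𝒪_Y) ⥤ D⁺(Mod 𝒪_Y)`.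
[cite: Weibel1994, Existence Thm. 10.5.6] -/
def derivedPushforwardPlusModelIso :
    InjectiveObject.derivedPlusModel X.Modules ⋙ derivedPushforwardPlus f ≅
      (InjectiveObject.ι X.Modules ⋙ Scheme.Modules.pushforward f).mapHomotopyCategoryPlus ⋙
        DerivedCategory.Plus.Qh :=
  (Scheme.Modules.pushforward f).rightDerivedFunctorPlusModelIso

/-! ### Existence of injective resolutions (bookkeeping) and the affine case -/

omit [HasDerivedCategory X.Modules] in
/-- Every bounded-below complex of `𝒪_X`-modules concentrated in degrees `≥ n` has an injective resolution
`ι : E• ⥲ I•` by a complex of injective `𝒪_X`-modules concentrated in degrees `≥ n` (enough injectives in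
`Mod(𝒪_X)`, Mathlib's CM5a factorisation for `C⁺`). [cite: Hartshorne1977, III §1 p. 204 (injective resolutions) with III Prop. 2.2]
[cite: Weibel1994, Lemma 5.7.2 and Thm. 10.4.8 (bounded-below injective resolutions)] -/
theorem exists_injective_resolution (E : CochainComplex.Plus X.Modules) (n : ℤ) [E.obj.IsStrictlyGE n] :
    ∃ (I : CochainComplex.Plus X.Modules) (_ : I.obj.IsStrictlyGE n) (_ : ∀ k : ℤ, Injective (I.obj.X k))
      (ι : E ⟶ I), QuasiIso ι.hom := by
  obtain ⟨L, hL, i, hi⟩ := CochainComplex.Plus.exists_quasiIso_injective E n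
  refine ⟨(InjectiveObject.ι X.Modules).mapCochainComplexPlus.obj L, ?_, fun k => ?_, i, ?_⟩
  · exact inferInstanceAs (CochainComplex.IsStrictlyGE
      (((InjectiveObject.ι X.Modules).mapHomologicalComplex (ComplexShape.up ℤ)).obj L.obj) n)
  · exact inferInstanceAs (Injective (L.obj.X k).obj)
  · exact (HomologicalComplex.mem_quasiIso_iff _).mp hi

/-- **`Rf_*E• ≅ f_*E•` for `f` AFFINE and `E•` a bounded-below complex of affine-localizing (e.g.
quasi-coherent) `𝒪_X`-modules** — Leray's acyclicity lemma of the tree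
(`Modules/PushforwardInjectiveResolution.quasiIso_pushforward_map_of_injective`: `f_*` of an injective
resolution of such an `E•` is a quasi-isomorphism) read in `D⁺(Mod 𝒪_Y)`: the derived direct image of this
file AGREES with the termwise direct image used by the affine-only `Modules/PullbackPushforwardDerivedAdjunction`.
[cite: Hartshorne1977, III Prop. 8.1] [cite: StacksProject, Tag 01XC] [cite: Weibel1994, Cor. 10.5.9] -/
theorem nonempty_derivedPushforwardPlus_obj_iso_of_isAffineHom [IsAffineHom f] (E : CochainComplex.Plus X.Modules)
    (hE : ∀ n : ℤ, IsAffineLocalizing (E.obj.X n)) :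
    Nonempty ((derivedPushforwardPlus f).obj (DerivedCategory.Plus.Q.obj E) ≅
      DerivedCategory.Plus.Q.obj ((Scheme.Modules.pushforward f).mapCochainComplexPlus.obj E)) := by
  obtain ⟨a, ha⟩ := E.property
  obtain ⟨I, hIa, hI, ι, hι⟩ := exists_injective_resolution E a
  -- Leray: `f_*ι : f_*E• ⟶ f_*I•` is a quasi-isomorphism
  haveI : QuasiIso ((Scheme.Modules.pushforward f).mapCochainComplexPlus.map ι).hom :=
    quasiIso_pushforward_map_of_injective f ι.hom a (fun n hn => E.obj.isZero_of_isStrictlyGE a n hn)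
      (fun n hn => I.obj.isZero_of_isStrictlyGE a n hn) hE hI
  haveI := Functor.isIso_Q_map_of_quasiIso (C := Y.Modules) ((Scheme.Modules.pushforward f).mapCochainComplexPlus.map ι)
  exact ⟨derivedPushforwardPlusObjIso f ι ≪≫
    (asIso (DerivedCategory.Plus.Q.map ((Scheme.Modules.pushforward f).mapCochainComplexPlus.map ι))).symm⟩

end Literature.AlgebraicGeometry.Modules

end
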